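import Summits.ValiantsHypothesis.ValiantsHypothesis.Theorems.KPlusLogSqLawTridiagonalRealStaticPotentialSteps
import Literature.Algebra.Polynomial.DescartesSignVariations

/-!
# Route «KPlusLogSqLaw», crux `WeakLifting` (stmt-ValiantsHypothesis-19561) — REAL side of the tridiagonal sector:
# CONJECTURE (P) IS FALSE — the one-step potential law fails at step `k = 3` (size `m = 5`)

HONEST FRAMING.  Helper (`--supports stmt-ValiantsHypothesis-19561 --as helper`), seat val-sym-lift-p1 (g13), cell `pub-symmetroid`,
2026-08-28.  The α register's UPPER side was reduced by val-sym-lift-p3 g10 to the cell's located conjecture (P)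
(`…TridiagonalRealStaticPotentialDefs.PotentialLawP`, an `@[conjecture]`: for every static definite symmetric tridiagonal monomial design
with nonzero links and every `k`, `Θ(rootWord D_{k+1} D_{k+2}) ≤ Θ(rootWord D_k D_{k+1}) + 2`), with the conditional row
`card_posRoots_le_of_potentialLawP : PotentialLawP → card posRoots ≤ 2m − 2`.  THIS FILE REFUTES (P) BY AN EXPLICIT `5 × 5` DESIGN:
`not_potentialStep_three : ¬ PotentialStep 3` and `not_potentialLawP : ¬ PotentialLawP`.  The design (continuant currency `pathDet a d b f`):
`a ≡ 1`, `d = (8, 0, 2, 1, 1)`, `b = (17/10, 17, 10, 9/25)`, `f = (0, 0, 8, 9)`, i.e. normalised edge weights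
`W = (2.89·x⁻⁸, 289·x⁻², 100·x¹³, 0.1296·x¹⁶)`.  Then
* `D₃ = X¹⁰ − 289 X⁸ − 2.89 X²` has ONE sign variation, hence exactly ONE positive root counted with multiplicity (Descartes' rule of signs,
  `Literature…signVariations_eq_one_of_pattern` + `countP_roots_pos_eq_one_of_signVariations_eq_one`);
* `D₄ = X¹¹ − 289 X⁹ − 2.89 X³ − 100 X²⁴ + 289 X¹⁶` has NO positive root: `−D₄(x) = 289x⁹ + x³(x⁸ − 2.89)(100x¹³ − 1) > 0` on `(0, ∞)`
  (elementary case analysis `eval_D4_explicit_neg`);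
* `D₅ = X·D₄ − (81/625)·X¹⁸·D₃` takes the signs `−, +, −, +, −` at `x = 1, 11/10, 2, 8, 32`, hence has at least FOUR distinct positive roots
  (tree `SymmetroidDescartes.le_card_posRoots_of_alternating`).
So `rootWord D₃ D₄` has length `1 + 0 = 1` and `Θ(rootWord D₃ D₄) ≤ 1` (`theta_le_length`, `length_rootWord`), while `rootWord D₄ D₅` has at
least four letters `q` and `Θ(rootWord D₄ D₅) ≥ 4` (`card_posRoots_le_count_true`, `count_le_theta`): the potential jumps by `3 > 2`.
CONSEQUENCES, HONESTLY: the LOCAL law (P) is dead and the hypothesis of the conditional upper row is false (the bounded form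
`card_posRoots_le_of_potentialSteps` is vacuous from `m = 5` on); NOT refuted are the CHAIN form «`Θ(rootWord D_{m−1} D_m) ≤ 2(m − 1)`» (all that
the row `Z ≤ 2m − 2` needs; here `Θ = 4 ≤ 8`), the two-step form «`Θ(w_{k+2}) ≤ Θ(w_k) + 4`» (here `4 ≤ 1 + 4`), the game cap
(`theta_le_of_relaxedReach`, a statement about the MODEL) and the α conjecture `Z ≤ 2m − 2` itself.  How found: a float climber on the Θ-margin
with slopes `|L| ≤ 24` (lift-p3 g9's adversarial tests had `|L| ≤ 8`; their memo §8(1a) asked for larger slopes), then an 80-digit scan and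
the exact certificate below.  Nothing here bears on `WeakLifting` / `TropicalB` (stmt-19771) in their windows, on Conjecture B, on the Door-A
registers, on `MatrixDescartes` (stmt-ValiantsHypothesis-18050) or on VP ≠ VNP.
[this cell's conjecture (P), memo HIERARCHICAL-LIMIT-GAME-liftp3g9.md §7b, REFUTED here; folklore: Descartes' rule of signs, intermediate values]
-/

-- `Summit.ValiantsHypothesis.ValiantsHypothesis.…` repeats a component by the D-0017 layout (single-conjunct summit); the name is mandated.
set_option linter.dupNamespace false
set_option autoImplicit false

namespace Summit.ValiantsHypothesis.ValiantsHypothesis.Theorems.KPlusLogSqLaw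

namespace StaticTridiagonalRealCut

open Polynomial
open Summit.ValiantsHypothesis.ValiantsHypothesis.Theorems.KPlusLogSqLaw.StaticTridiagonalRealPotential
  (pathDet pathDet_zero pathDet_one pathDet_add_two theta rootWord PotentialStep PotentialLawP theta_le_length length_rootWord
    count_le_theta card_posRoots_le_count_true)
open Literature.Algebra.Polynomial.Descartes (signVariations_eq_one_of_pattern countP_roots_pos_eq_one_of_signVariations_eq_one)
open Summit.ValiantsHypothesis.ValiantsHypothesis.Theorems.SymmetroidDescartes (le_card_posRoots_of_alternating)

/-! ### The three explicit continuants of the witness design -/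

/-- Coefficients of `D₃ = X¹⁰ − 289 X⁸ − 2.89 X²`. [bookkeeping] -/
theorem coeff_D3_explicit (k : ℕ) :
    ((X : ℝ[X]) ^ 10 - C (289 : ℝ) * X ^ 8 - C (289 / 100 : ℝ) * X ^ 2).coeff k =
      (if k = 10 then 1 else 0) - 289 * (if k = 8 then 1 else 0) - 289 / 100 * (if k = 2 then 1 else 0) := by
  simp only [coeff_sub, coeff_C_mul, coeff_X_pow]

/-- **`D₃` has exactly one positive root, counted with multiplicity** (one sign variation: Descartes). [folklore: Descartes] -/
theorem countP_roots_pos_D3_explicit :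
    ((X : ℝ[X]) ^ 10 - C (289 : ℝ) * X ^ 8 - C (289 / 100 : ℝ) * X ^ 2).roots.countP (fun x => 0 < x) = 1 := by
  refine countP_roots_pos_eq_one_of_signVariations_eq_one (signVariations_eq_one_of_pattern 10 ?_ ?_ ⟨2, ?_⟩ ⟨10, ?_⟩)
  · intro k hk
    rw [coeff_D3_explicit]
    have h10 : k ≠ 10 := by omega
    rw [if_neg h10]
    split_ifs <;> norm_num
  · intro k hk
    rw [coeff_D3_explicit]
    have h8 : k ≠ 8 := by omega
    have h2 : k ≠ 2 := by omega
    rw [if_neg h8, if_neg h2]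
    split_ifs <;> norm_num
  · rw [coeff_D3_explicit]; norm_num
  · rw [coeff_D3_explicit]; norm_num

/-- The auxiliary inequality `100 x¹⁵ − 289 x⁷ + 289 ≥ 0` on `1 < x`, `x⁸ < 2.89` (three monotone sub-cases). [bookkeeping] -/
theorem aux_g_nonneg (x : ℝ) (h1 : 1 < x) (h8 : x ^ 8 < 289 / 100) : 0 ≤ 100 * x ^ 15 - 289 * x ^ 7 + 289 := by
  have hx : 0 < x := by linarith
  have e15 : x ^ 15 = x ^ 8 * x ^ 7 := by ring
  have hx7pos : 0 < x ^ 7 := pow_pos hx 7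
  rcases le_or_gt x (21 / 20) with ha | ha
  · -- x ≤ 21/20 : x^15 ≥ x^7 and x^7 ≤ (21/20)^7 < 289/189
    have hx8 : 1 ≤ x ^ 8 := one_le_pow₀ h1.le
    have hx7 : x ^ 7 ≤ (21 / 20 : ℝ) ^ 7 := pow_le_pow_left₀ hx.le ha 7
    have hnum : (21 / 20 : ℝ) ^ 7 < 289 / 189 := by norm_num
    nlinarith [mul_le_mul_of_nonneg_right hx8 hx7pos.le]
  rcases le_or_gt x (11 / 10) with hb | hb
  · -- 21/20 < x ≤ 11/10
    have hx8 : (21 / 20 : ℝ) ^ 8 ≤ x ^ 8 := pow_le_pow_left₀ (by norm_num) ha.le 8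
    have hx7 : x ^ 7 ≤ (11 / 10 : ℝ) ^ 7 := pow_le_pow_left₀ hx.le hb 7
    have hnum : (289 - 100 * (21 / 20 : ℝ) ^ 8) * (11 / 10 : ℝ) ^ 7 < 289 := by norm_num
    have hc : 0 ≤ 289 - 100 * (21 / 20 : ℝ) ^ 8 := by norm_num
    nlinarith [mul_le_mul_of_nonneg_right hx8 hx7pos.le, mul_le_mul_of_nonneg_left hx7 hc]
  · -- 11/10 < x, x^8 < 2.89 : x^7 = x^8 / x < 2.89 / (11/10)
    have hx8 : (11 / 10 : ℝ) ^ 8 ≤ x ^ 8 := pow_le_pow_left₀ (by norm_num) hb.le 8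
    have hx7 : x ^ 7 ≤ 289 / 100 / (11 / 10) := by
      rw [le_div_iff₀ (by norm_num : (0:ℝ) < 11 / 10)]
      have : x ^ 7 * (11 / 10) ≤ x ^ 7 * x := mul_le_mul_of_nonneg_left hb.le hx7pos.le
      have e8 : x ^ 7 * x = x ^ 8 := by ring
      linarith
    have hnum : (289 - 100 * (11 / 10 : ℝ) ^ 8) * (289 / 100 / (11 / 10)) < 289 := by norm_num
    have hc : 0 ≤ 289 - 100 * (11 / 10 : ℝ) ^ 8 := by norm_num
    nlinarith [mul_le_mul_of_nonneg_right hx8 hx7pos.le, mul_le_mul_of_nonneg_left hx7 hc]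

/-- **`D₄` has no positive root**: `D₄(x) = x¹¹ − 289x⁹ − 2.89x³ − 100x²⁴ + 289x¹⁶ < 0` for `x > 0`, because
`−D₄(x) = 289x⁹ + x³(x⁸ − 2.89)(100x¹³ − 1)` and the product is either non-negative or smaller than `289x⁹` in absolute value. [this file] -/
theorem eval_D4_explicit_neg (x : ℝ) (hx : 0 < x) :
    x ^ 11 - 289 * x ^ 9 - 289 / 100 * x ^ 3 - 100 * x ^ 24 + 289 * x ^ 16 < 0 := by
  have key : 0 < 289 * x ^ 9 + x ^ 3 * (x ^ 8 - 289 / 100) * (100 * x ^ 13 - 1) := by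
    have hx3 : 0 < x ^ 3 := pow_pos hx 3
    have hx9 : 0 < x ^ 9 := pow_pos hx 9
    rcases le_or_gt x 1 with h1 | h1
    · have hx8 : x ^ 8 ≤ 1 := pow_le_one₀ hx.le h1
      rcases le_or_gt (100 * x ^ 13) 1 with h13 | h13
      · have hprod : 0 ≤ (x ^ 8 - 289 / 100) * (100 * x ^ 13 - 1) :=
          mul_nonneg_of_nonpos_of_nonpos (by linarith) (by linarith)
        nlinarith [mul_nonneg hx3.le hprod]
      · -- `x³ (2.89 − x⁸)(100x¹³ − 1) < x³ · 2.89 · 100 x¹³ = 289 x¹⁶ ≤ 289 x⁹`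
        have hx16 : x ^ 16 ≤ x ^ 9 := pow_le_pow_of_le_one hx.le h1 (by norm_num)
        have hx13 : 0 < x ^ 13 := pow_pos hx 13
        have h2 : (289 / 100 - x ^ 8) * (100 * x ^ 13 - 1) < 289 / 100 * (100 * x ^ 13) := by
          nlinarith [pow_pos hx 8]
        have h3 : x ^ 3 * ((289 / 100 - x ^ 8) * (100 * x ^ 13 - 1)) < x ^ 3 * (289 / 100 * (100 * x ^ 13)) :=
          mul_lt_mul_of_pos_left h2 hx3
        have e16 : x ^ 3 * (289 / 100 * (100 * x ^ 13)) = 289 * x ^ 16 := by ring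
        nlinarith
    · rcases le_or_gt (289 / 100) (x ^ 8) with h8 | h8
      · have h13 : 1 ≤ x ^ 13 := one_le_pow₀ h1.le
        have hprod : 0 ≤ (x ^ 8 - 289 / 100) * (100 * x ^ 13 - 1) := mul_nonneg (by linarith) (by linarith)
        nlinarith [mul_nonneg hx3.le hprod]
      · -- `1 < x`, `x⁸ < 2.89`: `(2.89 − x⁸)(100x¹³ − 1) < (2.89 − x⁸)·100x¹³ = x⁶ (289x⁷ − 100x¹⁵) ≤ 289 x⁶`
        have hg := aux_g_nonneg x h1 h8
        have hx6 : 0 < x ^ 6 := pow_pos hx 6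
        have hx13 : 0 < x ^ 13 := pow_pos hx 13
        have h2 : (289 / 100 - x ^ 8) * (100 * x ^ 13 - 1) < (289 / 100 - x ^ 8) * (100 * x ^ 13) := by
          nlinarith
        have e : (289 / 100 - x ^ 8) * (100 * x ^ 13) = x ^ 6 * (289 * x ^ 7 - 100 * x ^ 15) := by ring
        have h4 : x ^ 6 * (289 * x ^ 7 - 100 * x ^ 15) ≤ x ^ 6 * 289 := mul_le_mul_of_nonneg_left (by linarith) hx6.le
        have h5 : (289 / 100 - x ^ 8) * (100 * x ^ 13 - 1) < 289 * x ^ 6 := by linarith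
        have h6 : x ^ 3 * ((289 / 100 - x ^ 8) * (100 * x ^ 13 - 1)) < x ^ 3 * (289 * x ^ 6) := mul_lt_mul_of_pos_left h5 hx3
        have e9 : x ^ 3 * (289 * x ^ 6) = 289 * x ^ 9 := by ring
        nlinarith
  nlinarith [key]

/-! ### The refutation -/

/-- **CONJECTURE (P) FAILS AT STEP `k = 3`**: for the static definite symmetric tridiagonal `5 × 5` design `a ≡ 1`, `d = (8,0,2,1,1)`,
`b = (17/10, 17, 10, 9/25)`, `f = (0,0,8,9)` (nonzero links), `Θ(rootWord D₄ D₅) ≥ 4 > 1 + 2 ≥ Θ(rootWord D₃ D₄) + 2`. [this file] -/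
theorem not_potentialStep_three : ¬ PotentialStep 3 := by
  classical
  intro hP
  -- the witness design
  set af : ℕ → ℝ := fun _ => 1 with haf
  set df : ℕ → ℕ := fun t => if t = 0 then 8 else if t = 1 then 0 else if t = 2 then 2 else 1 with hdf
  set bf : ℕ → ℝ := fun t => if t = 0 then 17 / 10 else if t = 1 then 17 else if t = 2 then 10 else if t = 3 then 9 / 25 else 1
    with hbf
  set ff : ℕ → ℕ := fun t => if t = 2 then 8 else if t = 3 then 9 else 0 with hff
  have ha : ∀ t, 0 < af t := fun t => by simp [haf]
  have hb : ∀ t, bf t ≠ 0 := by intro t; simp only [hbf]; split_ifs <;> norm_num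
  have H := hP af df bf ff ha hb
  set D : ℕ → ℝ[X] := pathDet af df bf ff with hDdef
  have av : ∀ t, af t = 1 := fun t => by simp [haf]
  have d0 : df 0 = 8 := by simp [hdf]
  have d1 : df 1 = 0 := by simp [hdf]
  have d2 : df 2 = 2 := by simp [hdf]
  have d3 : df 3 = 1 := by simp [hdf]
  have d4 : df 4 = 1 := by simp [hdf]
  have b0 : bf 0 = 17 / 10 := by simp [hbf]
  have b1 : bf 1 = 17 := by simp [hbf]
  have b2 : bf 2 = 10 := by simp [hbf]
  have b3 : bf 3 = 9 / 25 := by simp [hbf]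
  have f0 : ff 0 = 0 := by simp [hff]
  have f1 : ff 1 = 0 := by simp [hff]
  have f2 : ff 2 = 8 := by simp [hff]
  have f3 : ff 3 = 9 := by simp [hff]
  -- the continuants, evaluated
  have hD0 : D 0 = 1 := pathDet_zero _ _ _ _
  have hrec : ∀ (n : ℕ) (x : ℝ), (D (n + 2)).eval x =
      af (n + 1) * x ^ df (n + 1) * (D (n + 1)).eval x - (bf n * x ^ ff n) ^ 2 * (D n).eval x := by
    intro n x
    rw [hDdef, pathDet_add_two]
    simp only [eval_sub, eval_mul, eval_pow, eval_C, eval_X]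
  have hev1 : ∀ x : ℝ, (D 1).eval x = x ^ 8 := by
    intro x; rw [hDdef, pathDet_one]; norm_num [haf, hdf]
  have hev2 : ∀ x : ℝ, (D 2).eval x = x ^ 8 - 289 / 100 := by
    intro x; rw [hrec 0 x, hev1, hD0]; norm_num [haf, hdf, hbf, hff]
  have hev3 : ∀ x : ℝ, (D 3).eval x = x ^ 10 - 289 * x ^ 8 - 289 / 100 * x ^ 2 := by
    intro x; rw [hrec 1 x, hev2, hev1]; norm_num [haf, hdf, hbf, hff]; ring
  have hev4 : ∀ x : ℝ, (D 4).eval x = x ^ 11 - 289 * x ^ 9 - 289 / 100 * x ^ 3 - 100 * x ^ 24 + 289 * x ^ 16 := by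
    intro x; rw [hrec 2 x, hev3, hev2]; norm_num [haf, hdf, hbf, hff]; ring
  have hev5 : ∀ x : ℝ, (D 5).eval x = x * (x ^ 11 - 289 * x ^ 9 - 289 / 100 * x ^ 3 - 100 * x ^ 24 + 289 * x ^ 16)
      - 81 / 625 * x ^ 18 * (x ^ 10 - 289 * x ^ 8 - 289 / 100 * x ^ 2) := by
    intro x; rw [hrec 3 x]; simp only [Nat.reduceAdd, av, d4, b3, f3, hev4, hev3]; ring
  -- `D₃` as an explicit polynomial (for Descartes)
  have hD3 : D 3 = X ^ 10 - C (289 : ℝ) * X ^ 8 - C (289 / 100 : ℝ) * X ^ 2 :=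
    Polynomial.funext fun x => by rw [hev3]; simp [eval_sub, eval_mul, eval_pow, eval_C, eval_X]
  -- non-vanishing
  have hD3ne : D 3 ≠ 0 := fun h => by have := hev3 1; rw [h, eval_zero] at this; norm_num at this
  have hD4ne : D 4 ≠ 0 := fun h => by have := hev4 1; rw [h, eval_zero] at this; norm_num at this
  have hD5ne : D 5 ≠ 0 := fun h => by have := hev5 1; rw [h, eval_zero] at this; norm_num at this
  -- the counts for `D₃`, `D₄`
  have h3 : (D 3).roots.countP (fun x => 0 < x) = 1 := by rw [hD3]; exact countP_roots_pos_D3_explicit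
  have h4 : (D 4).roots.countP (fun x => 0 < x) = 0 := by
    rw [Multiset.countP_eq_zero]
    intro x hx hxpos
    have hroot := (mem_roots hD4ne).1 hx
    have hval := eval_D4_explicit_neg x hxpos
    rw [IsRoot.def, hev4] at hroot
    linarith
  have hth34 : theta (rootWord (D 3) (D 4)) ≤ 1 := by
    refine (theta_le_length _).trans ?_
    rw [length_rootWord (mul_ne_zero hD3ne hD4ne), h3, h4]
  -- four sign alternations of `D₅` at `1 < 11/10 < 2 < 8 < 32`
  have hs1 : (D 5).eval 1 < 0 := by rw [hev5]; norm_num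
  have hs2 : 0 < (D 5).eval (11 / 10) := by rw [hev5]; norm_num
  have hs3 : (D 5).eval 2 < 0 := by rw [hev5]; norm_num
  have hs4 : 0 < (D 5).eval 8 := by rw [hev5]; norm_num
  have hs5 : (D 5).eval 32 < 0 := by rw [hev5]; norm_num
  have h5 : 4 ≤ ((D 5).roots.toFinset.filter (fun t => 0 < t)).card := by
    refine le_card_posRoots_of_alternating (D 5) 4 ![1, 11 / 10, 2, 8, 32] ?_ ?_ ?_
    · refine Fin.strictMono_iff_lt_succ.2 fun j => ?_
      fin_cases j <;> simp <;> norm_num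
    · intro j; fin_cases j <;> simp
    · intro j
      fin_cases j
      · simpa using mul_neg_of_neg_of_pos hs1 hs2
      · simpa using mul_neg_of_pos_of_neg hs2 hs3
      · simpa using mul_neg_of_neg_of_pos hs3 hs4
      · simpa using mul_neg_of_pos_of_neg hs4 hs5
  have hth45 : 4 ≤ theta (rootWord (D 4) (D 5)) :=
    h5.trans ((card_posRoots_le_count_true (mul_ne_zero hD4ne hD5ne)).trans (count_le_theta _ true))
  -- the step `(P)_3` would give `Θ(rootWord D₄ D₅) ≤ Θ(rootWord D₃ D₄) + 2 ≤ 3`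
  have H' : theta (rootWord (D 4) (D 5)) ≤ theta (rootWord (D 3) (D 4)) + 2 := H
  omega

/-- **CONJECTURE (P) (`PotentialLawP`) IS FALSE.** [this file] -/
theorem not_potentialLawP : ¬ PotentialLawP := fun h => not_potentialStep_three (h 3)

/-! ### Appendix (second filing): localised alternation count; the bounded hypothesis fails from `m = 5`; four new zeros in ONE cell -/

/-- Localised alternation count: `N` sign alternations of `p` along `τ 0 < ⋯ < τ N` give at least `N` distinct roots strictly between
`τ 0` and `τ N` (intermediate values; the tree's `le_card_posRoots_of_alternating` with the window recorded). [folklore] -/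
theorem le_card_roots_between_of_alternating (p : ℝ[X]) (N : ℕ) (τ : Fin (N + 1) → ℝ) (hτ : StrictMono τ)
    (halt : ∀ j : Fin N, p.eval (τ j.castSucc) * p.eval (τ j.succ) < 0) :
    N ≤ (p.roots.toFinset.filter (fun t => τ 0 < t ∧ t < τ (Fin.last N))).card := by
  have hroot : ∀ j : Fin N, ∃ r, τ j.castSucc < r ∧ r < τ j.succ ∧ p.IsRoot r := by
    intro j
    have hlt : τ j.castSucc < τ j.succ := hτ (by exact Fin.castSucc_lt_succ)
    have hcont : ContinuousOn (fun x => p.eval x) (Set.Icc (τ j.castSucc) (τ j.succ)) :=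
      p.continuous.continuousOn
    rcases mul_neg_iff.1 (halt j) with ⟨h1, h2⟩ | ⟨h1, h2⟩
    · obtain ⟨r, ⟨hr1, hr2⟩, hr⟩ := intermediate_value_Ioo' hlt.le hcont ⟨h2, h1⟩
      exact ⟨r, hr1, hr2, hr⟩
    · obtain ⟨r, ⟨hr1, hr2⟩, hr⟩ := intermediate_value_Ioo hlt.le hcont ⟨h1, h2⟩
      exact ⟨r, hr1, hr2, hr⟩
  choose r hr₁ hr₂ hr₃ using hroot
  have hmono : StrictMono r := by
    intro i j hij
    have hij' : (i : ℕ) < j := hij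
    calc r i < τ i.succ := hr₂ i
      _ ≤ τ j.castSucc := hτ.monotone (by
          rw [Fin.le_def, Fin.val_succ, Fin.val_castSucc]
          exact hij')
      _ < r j := hr₁ j
  calc N = (Finset.univ : Finset (Fin N)).card := by simp
    _ ≤ (p.roots.toFinset.filter (fun t => τ 0 < t ∧ t < τ (Fin.last N))).card := by
      refine Finset.card_le_card_of_injOn r (fun j _ => ?_) hmono.injective.injOn
      have hp : p ≠ 0 := by
        rintro rfl
        exact (lt_irrefl (0 : ℝ)) (by simpa using halt j)
      simp only [Finset.mem_coe, Finset.mem_filter, Multiset.mem_toFinset, Polynomial.mem_roots hp]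
      refine ⟨hr₃ j, ?_, ?_⟩
      · exact lt_of_le_of_lt (hτ.monotone (Fin.zero_le _)) (hr₁ j)
      · exact lt_of_lt_of_le (hr₂ j) (hτ.monotone (Fin.le_last _))

/-- The bounded hypothesis of the conditional row (`card_posRoots_le_of_potentialSteps`: the steps `(P)_k` with `k + 2 ≤ m`) is FALSE for
every `m ≥ 5`. [corollary] -/
theorem not_forall_potentialStep_of_five_le (m : ℕ) (hm : 5 ≤ m) : ¬ (∀ k : ℕ, k + 2 ≤ m → PotentialStep k) :=
  fun h => not_potentialStep_three (h 3 (by omega))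

/-- **FOUR NEW ZEROS IN ONE CELL.**  For the witness design of `not_potentialStep_three`, every positive zero of `D₃ · D₄` exceeds `17`
(`D₄` has none; `D₃`'s single one has `x² > 289`), while `D₅` has at least four zeros in `(1, 16)`: the four new letters of
`rootWord D₄ D₅` all fall into ONE cell of the older word `rootWord D₃ D₄`, so no law «at most `c` zeros of `D_{k+2}` per cell of
`rootWord D_k D_{k+1}`» holds with `c ≤ 3`. [this file] -/
theorem four_zeros_in_one_cell : ∃ (a : ℕ → ℝ) (d : ℕ → ℕ) (b : ℕ → ℝ) (f : ℕ → ℕ), (∀ t, 0 < a t) ∧ (∀ t, b t ≠ 0) ∧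
    (∀ x : ℝ, 0 < x → (pathDet a d b f 3 * pathDet a d b f 4).eval x = 0 → 17 < x) ∧
    4 ≤ ((pathDet a d b f 5).roots.toFinset.filter (fun t => 1 < t ∧ t < 16)).card := by
  classical
  set af : ℕ → ℝ := fun _ => 1 with haf
  set df : ℕ → ℕ := fun t => if t = 0 then 8 else if t = 1 then 0 else if t = 2 then 2 else 1 with hdf
  set bf : ℕ → ℝ := fun t => if t = 0 then 17 / 10 else if t = 1 then 17 else if t = 2 then 10 else if t = 3 then 9 / 25 else 1
    with hbf
  set ff : ℕ → ℕ := fun t => if t = 2 then 8 else if t = 3 then 9 else 0 with hff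
  have ha : ∀ t, 0 < af t := fun t => by simp [haf]
  have hb : ∀ t, bf t ≠ 0 := by intro t; simp only [hbf]; split_ifs <;> norm_num
  refine ⟨af, df, bf, ff, ha, hb, ?_, ?_⟩
  all_goals
    set D : ℕ → ℝ[X] := pathDet af df bf ff with hDdef
    have av : ∀ t, af t = 1 := fun t => by simp [haf]
    have d4 : df 4 = 1 := by simp [hdf]
    have b3 : bf 3 = 9 / 25 := by simp [hbf]
    have f3 : ff 3 = 9 := by simp [hff]
    have hD0 : D 0 = 1 := pathDet_zero _ _ _ _
    have hrec : ∀ (n : ℕ) (x : ℝ), (D (n + 2)).eval x =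
        af (n + 1) * x ^ df (n + 1) * (D (n + 1)).eval x - (bf n * x ^ ff n) ^ 2 * (D n).eval x := by
      intro n x
      rw [hDdef, pathDet_add_two]
      simp only [eval_sub, eval_mul, eval_pow, eval_C, eval_X]
    have hev1 : ∀ x : ℝ, (D 1).eval x = x ^ 8 := by
      intro x; rw [hDdef, pathDet_one]; norm_num [haf, hdf]
    have hev2 : ∀ x : ℝ, (D 2).eval x = x ^ 8 - 289 / 100 := by
      intro x; rw [hrec 0 x, hev1, hD0]; norm_num [haf, hdf, hbf, hff]
    have hev3 : ∀ x : ℝ, (D 3).eval x = x ^ 10 - 289 * x ^ 8 - 289 / 100 * x ^ 2 := by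
      intro x; rw [hrec 1 x, hev2, hev1]; norm_num [haf, hdf, hbf, hff]; ring
    have hev4 : ∀ x : ℝ, (D 4).eval x = x ^ 11 - 289 * x ^ 9 - 289 / 100 * x ^ 3 - 100 * x ^ 24 + 289 * x ^ 16 := by
      intro x; rw [hrec 2 x, hev3, hev2]; norm_num [haf, hdf, hbf, hff]; ring
    have hev5 : ∀ x : ℝ, (D 5).eval x = x * (x ^ 11 - 289 * x ^ 9 - 289 / 100 * x ^ 3 - 100 * x ^ 24 + 289 * x ^ 16)
        - 81 / 625 * x ^ 18 * (x ^ 10 - 289 * x ^ 8 - 289 / 100 * x ^ 2) := by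
      intro x; rw [hrec 3 x]; simp only [Nat.reduceAdd, av, d4, b3, f3, hev4, hev3]; ring
  · -- every positive zero of `D₃ · D₄` exceeds `17`
    intro x hx hzero
    rw [eval_mul] at hzero
    rcases mul_eq_zero.1 hzero with h3 | h4
    · rw [hev3] at h3
      by_contra hle
      push Not at hle
      have hx2 : x ^ 2 ≤ 289 := by nlinarith
      have hx8 : 0 ≤ x ^ 8 := by positivity
      have : x ^ 10 - 289 * x ^ 8 = x ^ 8 * (x ^ 2 - 289) := by ring
      nlinarith [mul_nonpos_of_nonneg_of_nonpos hx8 (by linarith : x ^ 2 - 289 ≤ 0), pow_pos hx 2]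
    · rw [hev4] at h4
      have := eval_D4_explicit_neg x hx
      linarith
  · -- four alternations of `D₅` at `1 < 11/10 < 2 < 8 < 16`
    have hs1 : (D 5).eval 1 < 0 := by rw [hev5]; norm_num
    have hs2 : 0 < (D 5).eval (11 / 10) := by rw [hev5]; norm_num
    have hs3 : (D 5).eval 2 < 0 := by rw [hev5]; norm_num
    have hs4 : 0 < (D 5).eval 8 := by rw [hev5]; norm_num
    have hs5 : (D 5).eval 16 < 0 := by rw [hev5]; norm_num
    have h := le_card_roots_between_of_alternating (D 5) 4 ![1, 11 / 10, 2, 8, 16] ?_ ?_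
    · simpa using h
    · refine Fin.strictMono_iff_lt_succ.2 fun j => ?_
      fin_cases j <;> simp <;> norm_num
    · intro j
      fin_cases j
      · simpa using mul_neg_of_neg_of_pos hs1 hs2
      · simpa using mul_neg_of_pos_of_neg hs2 hs3
      · simpa using mul_neg_of_neg_of_pos hs3 hs4
      · simpa using mul_neg_of_pos_of_neg hs4 hs5

end StaticTridiagonalRealCut

end Summit.ValiantsHypothesis.ValiantsHypothesis.Theorems.KPlusLogSqLaw
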